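import Summits.HubbardSuperconductivity.HubbardSuperconductivity.Theorems.AnisotropyChordStiffnessDefs
import Summits.HubbardSuperconductivity.HubbardSuperconductivity.Theorems.AnisotropyChordStiffnessNearField

/-!
# Route `AnisotropyChord` / H0 rotor rung: THEOREM TWIST-IR — the theory seat's typed hand-offs (S4)
# `NearFieldParseval` (PROVED here) and (S5)(c) `DiamagneticGridBound` (typed); Sketch8 Parts I, K ported

Theory seat `hubbard-h0-rotor-theory-1`, cycle 8, memo ROTOR-THEORY-8 §107/§109, CYCLE-8 REPORT 1b (iv).

* `InTorusBox L R r` — support in the centred box of half-width `R` (every reduced coordinate `≤ R`);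
* `NearFieldParseval` — L4/(S4) typed target — and **`nearFieldParseval_holds : NearFieldParseval`**, from the
  near-field lemma `norm_kernelFT_sub_kernelFT_zero_le` (`AnisotropyChordStiffnessNearField`; the typed
  hypothesis `2R < L` is not needed);
* `DiamagneticGridBound Δ M` — (S5)(c) typed: the diamagnetic grid bound `K^{tot}(k′) ≼ diag(tᵢ/2)` in
  variational form (Peierls twist + Kato–Simon entrywise inequality + second-order expansion; memo §109 recipe) —
  the prover seat's next target.
-/

set_option linter.dupNamespace false

noncomputable section

open Matrix Complex Finset Filter Topology
open scoped ComplexConjugate Real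
open Literature.MathematicalPhysics.QuantumLattice hiding torusPhase torusNorm
open Literature.Probability.LatticeModels
open Summit.HubbardSuperconductivity.HubbardSuperconductivity.Theorems.AnisotropyChord.InsertionEntropy

namespace Summit.HubbardSuperconductivity.HubbardSuperconductivity.Theorems.AnisotropyChord.Stiffness

/-! ## (S4) — the near-field Parseval lemma, typed and proved -/

/-- Support in the centred box of half-width `R`: every coordinate's reduced representative is `≤ R`
(`min(rᵢ.val, L − rᵢ.val) = |valMinAbs rᵢ|`). Theory seat Sketch8 Part K. [folklore] -/
def InTorusBox (L : ℕ) [NeZero L] (R : ℕ) (r : TorusSite 2 L) : Prop :=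
  ∀ i, min (r i).val (L - (r i).val) ≤ R

/-- **L4 / (S4) NEAR-FIELD PARSEVAL LEMMA — typed target** (theory seat memo ROTOR-THEORY-8 §107 L4, §109 (S4);
Sketch8 Part K): a real, even kernel on `(ℤ/L)²` supported in the box of half-width `R` (`2R < L`), whose transform
is bounded by `B` on the whole grid, has `|K̂(k) − K̂(0)| ≤ |k|_T² R² (2R+1) B`.
[conjecture: theory seat hubbard-h0-rotor-theory-1, cycle 8, 2026-08-28 — memo ROTOR-THEORY-8 §109 (S4); PROVED below (`nearFieldParseval_holds`)] -/
def NearFieldParseval : Prop :=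
  ∀ (L : ℕ) [NeZero L] (R : ℕ), 2 * R < L →
    ∀ (K : TorusSite 2 L → ℝ),
      (∀ r, ¬ InTorusBox L R r → K r = 0) →
      (∀ r, K (-r) = K r) →
      ∀ (B : ℝ), (∀ q, ‖kernelFT L K q‖ ≤ B) →
        ∀ k, ‖kernelFT L K k - kernelFT L K 0‖
              ≤ torusNorm L k ^ 2 * (R : ℝ) ^ 2 * (2 * R + 1) * B

/-- **`NearFieldParseval` HOLDS** — stub (S4) of THEOREM TWIST-IR is a tree theorem
(`norm_kernelFT_sub_kernelFT_zero_le`; the box condition is `|valMinAbs rᵢ| ≤ R` by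
`ZMod.valMinAbs_natAbs_eq_min`). [folklore] -/
theorem nearFieldParseval_holds : NearFieldParseval := by
  intro L _ R _ K hsupp heven B hB k
  have hsupp' : ∀ r, K r ≠ 0 → ∀ i, (r i).valMinAbs.natAbs ≤ R := by
    intro r hr i
    by_contra hcon
    apply hr
    apply hsupp r
    intro hbox
    apply hcon
    rw [ZMod.valMinAbs_natAbs_eq_min]
    exact hbox i
  exact norm_kernelFT_sub_kernelFT_zero_le K R B hsupp' heven hB k

/-! ## (S5)(c) — the diamagnetic grid bound, typed -/

/-- **DIAMAGNETIC GRID BOUND (S5)(c), variational form — typed** (theory seat Sketch8 Part I; memo §107 L3(c),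
§109).  For every lattice size, every Perron sector state `ψ = toC aM`, every grid momentum `k′` and every `η ∈ ℂ²`:
`m₋₁(Σᵢ ηᵢ Jⁱ_{k′}) ≤ ½ Σᵢ |ηᵢ|² ⟨ψ, (−Tᵢ) ψ⟩`, written as `2 |⟨φ, J_{η,k′} ψ⟩|² ≤ (Σᵢ |ηᵢ|² ⟨−Tᵢ⟩) · ⟨φ, (H − E₀) φ⟩`
for all `φ` in the sector.  RECIPE (memo §109): Peierls-twist the hopping by the bond field `A_b = ηᵢ e^{ik′·x}`;
the Kato–Simon entrywise inequality `⟨χ, H(A) χ⟩ ≥ ⟨|χ|, H |χ|⟩ ≥ E₀‖χ‖²` and the second-order expansion at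
`χ = ψ − εφ`.  Equality in the pure-gauge direction is the f-sum identity L3(b).
[conjecture: theory seat hubbard-h0-rotor-theory-1, cycle 8, 2026-08-28 — memo ROTOR-THEORY-8 §109 (S5)(c); handed to the prover seat] -/
def DiamagneticGridBound (Δ : ℝ) (M : ℕ → ℝ) : Prop :=
  ∀ (L : ℕ) [NeZero L] (aM : TensorIndex (TorusSite 2 L) 2 → ℝ),
    IsPerronSectorGroundAmplitude L Δ (M L - 1) aM →
      ∀ (k : TorusSite 2 L) (η : Fin 2 → ℂ) (φ : TensorIndex (TorusSite 2 L) 2 → ℂ),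
        φ ∈ spinZSector (Λ := TorusSite 2 L) 1 (M L - 1) →
          2 * ‖star φ ⬝ᵥ ((∑ i : Fin 2, η i • currentMode L k i) *ᵥ toC L aM)‖ ^ 2
            ≤ (∑ i : Fin 2, ‖η i‖ ^ 2 * (star (toC L aM) ⬝ᵥ (kineticOp L i *ᵥ toC L aM)).re)
              * (star φ ⬝ᵥ ((hcbHamiltonian L Δ
                    - ((lowestEnergyInSector 1 (hcbHamiltonian L Δ) (M L - 1) : ℝ) : ℂ)
                        • (1 : Op (TorusSite 2 L) 2)) *ᵥ φ)).re

end Summit.HubbardSuperconductivity.HubbardSuperconductivity.Theorems.AnisotropyChord.Stiffness
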